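import Summits.NavierStokesRegularity.NavierStokesRegularity.Theorems.SoloRefuteGeurdes2017
import Literature.Analysis.FluidPDE.LerayProfileCalculus
import Literature.Analysis.FluidPDE.LambFormCurlKernel
import HarnessLib

/-!
# C106 `Geurdes2017` — kernel refutation of Step 6 (the quantifier passage §2.8/(2.25) p.7, §3 p.8)

Text of record: H. Geurdes, Cogent Mathematics 4 (2017) 1284293 ≡ arXiv:1703.05113 v1, typed
skeleton `Literature.Claims.NS.Geurdes2017` (p473176); first file `SoloRefuteGeurdes2017` (p476475:
Steps 3a/3, the datum `U = abc 0 1 1 (2π·) ∈ 𝒰″`).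

§3 ¶1 p.8: «conclusions for v^h have their impact on u. If no v^h can be found then no u can be
found either. Therefore, it is sufficient to only look at the D breakdown yes-or-no possibility of
v^h» — typed `Step6_vhSufficiency`: for every `ν ≥ 0`, `c ≠ 0`, `u⁰ ∈ 𝒰″`, non-solvability of the
momentum equation for the author's trial field `v^h` at `t = h` (all `h ≥ 0`) ⇒ the Cauchy problem
`(u⁰, f^crl)` has NO smooth solution with periodic velocity.

* `noPressure_U` — the ANTECEDENT holds at `(ν, c, u⁰) = (1, e₃, U)`: the momentum identity for
  `v^h` at `t = h` forces `∇p(h,·) = ∇×U − (e₃ + ·)`, whose curl at `0` is `4π²U(0) ≠ 0`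
  (this is the paper's own §2.4–§2.7 computation, (2.17)/(2.23), made rigorous for this datum).
* `solvable_U` — the CONSEQUENT fails: `f^crl = κU`, `κ = 2π + 1 + 4π²`, lies in the curl
  eigenspace `E_{2π}` where `(u·∇)u = ∇(|u|²/2)` and `Δ = −4π²`, so
  `u(t,x) = φ(t)U(x)`, `p(t,x) = −φ(t)²|U(x)|²/2`, `φ(t) = a + (1 − a)e^{−4π²t}`, `a = κ/4π²`
  (`φ' = −4π²φ + κ`, `φ(0) = 1`) is a GLOBAL smooth solution, `u` and `p` both `ℤ³`-periodic
  (so even the errata reading is met): `clayPeriodic.Solvable 1 (fcrl 1 e₃ U) U`.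
* `not_Step6_vhSufficiency : ¬ Step6_vhSufficiency`.

The ∃-weakening `Step6E_vhSufficiencyExists` (some `c`, some `u⁰` per `ν`) is open-strength and is
NOT addressed. Tree facts used: `IsBeltrami.convect_eq_gradient`, `laplacian_smul`,
`laplacian_id_eq_zero`, `curl_gradient_eq_zero_holds`, `hasFDerivAt_half_norm_sq`.
Axioms: `propext`, `Classical.choice`, `Quot.sound`. Refuter: ns-claims-refuter-5 (convention (b)).

WHAT THIS IS NOT: not a claim about NS regularity or blow-up; not a claim about any author beyond the
typed locator.
-/

set_option linter.dupNamespace false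

open Set Real
open scoped RealInnerProductSpace ContDiff Laplacian Topology

namespace Summit.NavierStokesRegularity.NavierStokesRegularity.Theorems.Geurdes2017

open Literature.Analysis.FluidPDE Literature.Claims.NS Literature.Claims.NS.Geurdes2017

noncomputable section

/-! ## Small calculus facts -/

/-- `∇(c · ½|v|²) = c ∇(½|v|²)` at a point of differentiability of `v`. [folklore] -/
theorem gradient_const_mul_halfNormSq
    {v : EuclideanSpace ℝ (Fin 3) → EuclideanSpace ℝ (Fin 3)} {x : EuclideanSpace ℝ (Fin 3)}
    (hv : DifferentiableAt ℝ v x) (c : ℝ) :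
    gradient (fun y => c * (‖v y‖ ^ 2 / 2)) x = c • gradient (fun y => ‖v y‖ ^ 2 / 2) x := by
  have hg : HasGradientAt (fun y => ‖v y‖ ^ 2 / 2) (gradient (fun y => ‖v y‖ ^ 2 / 2) x) x :=
    (hasFDerivAt_half_norm_sq hv).differentiableAt.hasGradientAt
  have h : HasGradientAt (fun y => c * (‖v y‖ ^ 2 / 2))
      (c • gradient (fun y => ‖v y‖ ^ 2 / 2) x) x := by
    rw [hasGradientAt_iff_hasFDerivAt] at hg ⊢
    refine (hg.const_mul c).congr_fderiv ?_
    rw [map_smul]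
  exact h.gradient

/-- The curl of the affine field `y ↦ c + y` vanishes. [folklore] -/
theorem curl_const_add_self (c x : EuclideanSpace ℝ (Fin 3)) :
    curl (fun y => c + y) x = 0 := by
  have hf : fderiv ℝ (fun y : EuclideanSpace ℝ (Fin 3) => c + y) x = ContinuousLinearMap.id ℝ _ :=
    ((hasFDerivAt_id x).const_add c).fderiv
  unfold curl
  ext i
  fin_cases i <;> simp [hf]

/-- The Laplacian of the affine field `y ↦ c + y` vanishes. [folklore] -/
theorem laplacian_const_add_self (c x : EuclideanSpace ℝ (Fin 3)) :
    Δ (fun y : EuclideanSpace ℝ (Fin 3) => c + y) x = 0 := by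
  have h' : Δ ((fun _ : EuclideanSpace ℝ (Fin 3) => c) + fun y : EuclideanSpace ℝ (Fin 3) => y) x =
      Δ (fun _ : EuclideanSpace ℝ (Fin 3) => c) x + Δ (fun y : EuclideanSpace ℝ (Fin 3) => y) x :=
    contDiffAt_const.laplacian_add contDiff_id.contDiffAt
  rw [InnerProductSpace.laplacian_const, laplacian_id_eq_zero, Pi.zero_apply, zero_add] at h'
  exact h'

/-! ## The antecedent of Step 6 holds for `(1, e₃, U)`: no pressure for `v^h` at `t = h` -/

/-- `e₃ ≠ 0`. [folklore] -/
theorem single_two_ne_zero : (EuclideanSpace.single 2 1 : EuclideanSpace ℝ (Fin 3)) ≠ 0 := by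
  intro h0
  have := congrArg (fun v : EuclideanSpace ℝ (Fin 3) => v 2) h0
  simp at this

/-- `∂ₛ v^h(x,s)|_{s=h} = −DU(x)(x + U(x))` (one-sided derivative within `[0,∞)` at `h ≥ 0`;
(2.9)–(2.10) p.5). [cite: Geurdes2017, eqs. (2.9)–(2.10) p.5] -/
theorem derivWithin_vh_U (c : EuclideanSpace ℝ (Fin 3)) {h : ℝ} (hh : 0 ≤ h)
    (x : EuclideanSpace ℝ (Fin 3)) :
    derivWithin (fun s => vh U c h s x) (Ici 0) h = -(fderiv ℝ U x (x + U x)) := by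
  have hin : HasDerivAt (fun s : ℝ => x - (s - h) • (x + U x)) (-((1 : ℝ) • (x + U x))) h :=
    (((hasDerivAt_id h).sub_const h).smul_const (x + U x)).const_sub x
  have hx : x - (h - h) • (x + U x) = x := by simp
  have hU' : HasFDerivAt U (fderiv ℝ U x) (x - (h - h) • (x + U x)) := by
    rw [hx]; exact (differentiable_U x).hasFDerivAt
  have hcomp : HasDerivAt (fun s => vh U c h s x) (fderiv ℝ U x (-((1 : ℝ) • (x + U x)))) h :=
    (hU'.comp_hasDerivAt h hin).const_add (c + x)
  rw [one_smul, map_neg] at hcomp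
  exact hcomp.hasDerivWithinAt.derivWithin (uniqueDiffOn_Ici 0 h (mem_Ici.2 hh))

/-- The slice `v^h(·,h) = c + · + U`. [cite: Geurdes2017, eq. (2.5) p.4] -/
theorem vh_U_self (c : EuclideanSpace ℝ (Fin 3)) (h : ℝ) :
    vh U c h h = fun y => c + y + U y := funext fun y => vh_self U c h y

/-- **Antecedent of Step 6 at `(ν, c, u⁰) = (1, e₃, U)`** (the content of §2.4–§2.7 for this datum):
for every `h ≥ 0` there is no smooth pressure with which `v^h` satisfies the momentum equation at
`t = h` — it would force `∇p(h,·) = ∇×U − (e₃ + ·)`, but `∇×(∇×U − (e₃ + ·))(0) = 4π²U(0) ≠ 0`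
while the curl of a `C²` gradient vanishes. [cite: Geurdes2017, eqs. (2.17) p.6 and (2.23) p.7] -/
theorem noPressure_U (h : ℝ) (hh : 0 ≤ h) :
    ¬ ∃ p : ℝ → EuclideanSpace ℝ (Fin 3) → ℝ,
      IsSmoothOnHalfSpace p ∧ vhSolvesMomentumAt 1 (EuclideanSpace.single 2 1) U h p := by
  rintro ⟨p, hp, hmom⟩
  have hp' : IsSmoothSpaceTimeOn (Ici 0) p := hp
  have hp2 : ContDiff ℝ 2 (p h) := contDiff_infty.1 (hp'.contDiff_slice (mem_Ici.2 hh)) 2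
  have hgrad : ∀ x, gradient (p h) x = (2 * π) • U x - (EuclideanSpace.single 2 1 + x) := by
    intro x
    have hUx : DifferentiableAt ℝ U x := differentiable_U x
    have e := hmom x
    have h2 : fderiv ℝ (vh U (EuclideanSpace.single 2 1) h h) x =
        ContinuousLinearMap.id ℝ _ + fderiv ℝ U x := by
      rw [vh_U_self]
      exact (((hasFDerivAt_id x).const_add _).add hUx.hasFDerivAt).fderiv
    have h3 : Δ (vh U (EuclideanSpace.single 2 1) h h) x = -((2 * π) ^ 2) • U x := by
      have ha : ContDiffAt ℝ 2
          (fun y : EuclideanSpace ℝ (Fin 3) => EuclideanSpace.single 2 1 + y) x :=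
        (contDiff_const.add contDiff_id).contDiffAt
      have hb : ContDiffAt ℝ 2 U x := (contDiff_U (n := 2)).contDiffAt
      have hfu : vh U (EuclideanSpace.single 2 1) h h =
          (fun y : EuclideanSpace ℝ (Fin 3) => EuclideanSpace.single 2 1 + y) + U := by
        funext y; rw [vh_self]; rfl
      rw [hfu, ha.laplacian_add hb, laplacian_const_add_self, zero_add, laplacian_U]
    have hg : gradient (p h) x =
        (1 : ℝ) • Δ (vh U (EuclideanSpace.single 2 1) h h) x + fcrl 1 (EuclideanSpace.single 2 1) U h x -
          (derivWithin (fun s => vh U (EuclideanSpace.single 2 1) h s x) (Ici 0) h +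
            fderiv ℝ (vh U (EuclideanSpace.single 2 1) h h) x
              (vh U (EuclideanSpace.single 2 1) h h x)) := by
      rw [e]; abel
    rw [derivWithin_vh_U _ hh, h2, h3, fcrl_U, vh_self] at hg
    rw [hg]
    simp only [_root_.add_apply, ContinuousLinearMap.id_apply, map_add, fderiv_U_e3, one_smul]
    ext i
    simp only [PiLp.add_apply, PiLp.sub_apply, PiLp.smul_apply, PiLp.neg_apply, PiLp.zero_apply,
      smul_eq_mul]
    ring
  have hcurl0 : curl (gradient (p h)) 0 = 0 := curl_gradient_eq_zero_holds (p h) hp2 0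
  have hfun : gradient (p h) = fun x => (2 * π) • U x - (EuclideanSpace.single 2 1 + x) :=
    funext hgrad
  have hf' : DifferentiableAt ℝ (fun y => (2 * π) • U y) 0 :=
    (differentiable_U 0).const_smul (2 * π)
  have hg' : DifferentiableAt ℝ
      (fun y : EuclideanSpace ℝ (Fin 3) => EuclideanSpace.single 2 1 + y) 0 :=
    differentiableAt_id.const_add _
  rw [hfun, curl_sub hf' hg', curl_const_smul (differentiable_U 0), curl_U, smul_smul,
    curl_const_add_self, sub_zero] at hcurl0
  exact smul_ne_zero (by positivity) U_zero_ne_zero hcurl0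

/-! ## The consequent of Step 6 fails: the explicit global solution for `(U, f^crl)` -/

/-- `a = κ/4π²`, `κ = 2π + 1 + 4π²` (the equilibrium amplitude of `φ' = −4π²φ + κ`). [folklore] -/
def aCoef : ℝ := (2 * π + 1 + (2 * π) ^ 2) / (2 * π) ^ 2

/-- `φ(t) = a + (1 − a)e^{−4π²t}`, the solution of `φ' = −4π²φ + κ`, `φ(0) = 1`. [folklore] -/
def phi (t : ℝ) : ℝ := aCoef + (1 - aCoef) * exp (-(2 * π) ^ 2 * t)

/-- `φ(0) = 1`. [folklore] -/
theorem phi_zero : phi 0 = 1 := by simp [phi]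

/-- `φ' = −4π²φ + κ`. [folklore] -/
theorem hasDerivAt_phi (t : ℝ) :
    HasDerivAt phi (-(2 * π) ^ 2 * phi t + (2 * π + 1 + (2 * π) ^ 2)) t := by
  have h1 : HasDerivAt (fun s => -(2 * π) ^ 2 * s) (-(2 * π) ^ 2) t := by
    simpa using (hasDerivAt_id t).const_mul (-(2 * π) ^ 2)
  have h2 : HasDerivAt phi (0 + (1 - aCoef) * (exp (-(2 * π) ^ 2 * t) * (-(2 * π) ^ 2))) t :=
    (hasDerivAt_const t aCoef).add (h1.exp.const_mul (1 - aCoef))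
  refine h2.congr_deriv ?_
  have hL : (2 * π) ^ 2 ≠ 0 := by positivity
  simp only [phi, aCoef]
  field_simp
  ring

/-- `φ` is smooth. [folklore] -/
theorem contDiff_phi {n : WithTop ℕ∞} : ContDiff ℝ n phi :=
  contDiff_const.add (contDiff_const.mul (contDiff_exp.comp (contDiff_const.mul contDiff_id)))

/-- The velocity `u(t,x) = φ(t)U(x)`. [folklore] -/
def uSol (t : ℝ) (x : EuclideanSpace ℝ (Fin 3)) : EuclideanSpace ℝ (Fin 3) := phi t • U x

/-- The Bernoulli pressure `p(t,x) = −φ(t)²|U(x)|²/2`. [folklore] -/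
def pSol (t : ℝ) (x : EuclideanSpace ℝ (Fin 3)) : ℝ := -(phi t ^ 2 * (‖U x‖ ^ 2 / 2))

/-- `u` is smooth on `[0,∞) × ℝ³` (indeed on `ℝ × ℝ³`). [folklore] -/
theorem isSmoothOnHalfSpace_uSol : IsSmoothOnHalfSpace uSol :=
  ((contDiff_phi.comp contDiff_fst).smul (contDiff_U.comp contDiff_snd)).contDiffOn

/-- `p` is smooth on `[0,∞) × ℝ³`. [folklore] -/
theorem isSmoothOnHalfSpace_pSol : IsSmoothOnHalfSpace pSol :=
  (((contDiff_phi.comp contDiff_fst).pow 2).mul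
    (((contDiff_U.norm_sq ℝ).div_const 2).comp contDiff_snd)).neg.contDiffOn

/-- `u(0) = U`. [folklore] -/
theorem uSol_zero : uSol 0 = U := by
  funext x; simp [uSol, phi_zero]

/-- `u(t)` is `ℤ³`-periodic. [folklore] -/
theorem periodic_uSol (t : ℝ) : IsLatticePeriodic (uSol t) := fun j x => by
  simp only [uSol]; rw [periodic_U j x]

/-- `p(t)` is `ℤ³`-periodic (the errata clause, for the record). [folklore] -/
theorem periodic_pSol (t : ℝ) : IsLatticePeriodic (pSol t) := fun j x => by
  simp only [pSol]; rw [periodic_U j x]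

/-- `∇·u(t) = 0`. [folklore] -/
theorem isDivFree_uSol (t : ℝ) : NSWave0.IsDivFree (uSol t) := by
  intro x
  have hUx : DifferentiableAt ℝ U x := differentiable_U x
  show VectorCalculus.divergence (fun y => phi t • U y) x = 0
  unfold VectorCalculus.divergence
  rw [fderiv_fun_const_smul hUx]
  have := isDivFree_U x
  unfold VectorCalculus.divergence at this
  simp [this]

/-- **The momentum equation** `∂ₜu + (u·∇)u = Δu − ∇p + f^crl` on `[0,∞) × ℝ³` for
`u = φU`, `p = −φ²|U|²/2`, `f^crl = κU`: `φ'U + φ²∇(|U|²/2) = −4π²φU + φ²∇(|U|²/2) + κU`.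
[cite: Geurdes2017, eq. (1.1) p.3 with (2.18) p.6] -/
theorem momentum_uSol (t : ℝ) (ht : 0 ≤ t) (x : EuclideanSpace ℝ (Fin 3)) :
    derivWithin (fun s => uSol s x) (Ici 0) t + fderiv ℝ (uSol t) x (uSol t x) =
      (1 : ℝ) • (Δ (uSol t)) x - gradient (pSol t) x + fcrl 1 (EuclideanSpace.single 2 1) U t x := by
  have hUx : DifferentiableAt ℝ U x := differentiable_U x
  have h1 : derivWithin (fun s => uSol s x) (Ici 0) t =
      (-(2 * π) ^ 2 * phi t + (2 * π + 1 + (2 * π) ^ 2)) • U x :=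
    ((hasDerivAt_phi t).smul_const (U x)).hasDerivWithinAt.derivWithin
      (uniqueDiffOn_Ici 0 t (mem_Ici.2 ht))
  have h2 : fderiv ℝ (uSol t) x (uSol t x) =
      (phi t * phi t) • gradient (fun y => ‖U y‖ ^ 2 / 2) x := by
    rw [← isBeltrami_U.convect_eq_gradient hUx, convect_apply]
    show fderiv ℝ (fun y => phi t • U y) x (phi t • U x) = _
    rw [fderiv_fun_const_smul hUx (phi t)]
    simp [smul_smul]
  have h3 : Δ (uSol t) x = (phi t * -((2 * π) ^ 2)) • U x := by
    show Δ (phi t • U) x = _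
    rw [InnerProductSpace.laplacian_smul (phi t) (contDiff_U (n := 2)).contDiffAt, laplacian_U,
      smul_smul]
  have h4 : gradient (pSol t) x = (-(phi t * phi t)) • gradient (fun y => ‖U y‖ ^ 2 / 2) x := by
    have e : pSol t = fun y => (-(phi t * phi t)) * (‖U y‖ ^ 2 / 2) := by
      funext y; simp only [pSol]; ring
    rw [e, gradient_const_mul_halfNormSq hUx]
  rw [h1, h2, h3, h4, fcrl_U]
  ext i
  simp only [smul_smul, neg_smul, sub_neg_eq_add, PiLp.add_apply, PiLp.smul_apply, smul_eq_mul,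
    one_mul]
  ring

/-- **The consequent of Step 6 fails at `(1, e₃, U)`**: the Cauchy problem with datum `U` and the
paper's force `f^crl` HAS a global smooth solution with `ℤ³`-periodic velocity (Clay (B)/(D) sense,
`clayPeriodic.Solvable`). [cite: Geurdes2017, §3 ¶1 p.8] -/
theorem solvable_U : ClayVariants.clayPeriodic.Solvable 1 (fcrl 1 (EuclideanSpace.single 2 1) U) U :=
  ⟨uSol, pSol, isSmoothOnHalfSpace_uSol, isSmoothOnHalfSpace_pSol,
    ⟨momentum_uSol, fun t _ => isDivFree_uSol t, uSol_zero⟩, fun t _ => periodic_uSol t⟩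

/-- **Step 6 is false** (§2.8 (2.24)–(2.25) p.7 + §3 ¶1 p.8 «If no v^h can be found then no u
can be found either»): at `ν = 1`, `c = e₃`, `u⁰ = U ∈ 𝒰″` no `v^h` admits a pressure at `t = h`
(`noPressure_U`, any `h ≥ 0`), yet `(U, f^crl)` is globally, smoothly and periodically solvable
(`solvable_U`). [cite: Geurdes2017, §3 ¶1 p.8] -/
theorem not_Step6_vhSufficiency : ¬ Step6_vhSufficiency := fun h =>
  h 1 zero_le_one _ single_two_ne_zero U dataSubclass_U noPressure_U solvable_U

end

end Summit.NavierStokesRegularity.NavierStokesRegularity.Theorems.Geurdes2017
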